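import Summits.QuantumAdvantage.QuantumAdvantage.Theorems.RandomOracleGaugeDecoupledCoreAAL1FamilyEquiv
import Summits.QuantumAdvantage.QuantumAdvantage.Theorems.SosSandwichPseudoBoundedAAApproxBooleanCorner
import HarnessLib

/-!
# Crux `DecoupledCoreAA` (stmt-QuantumAdvantage-17872), line `l1-family`, stub `stub_l1Family` —
# POINTWISE-DOMINATED families (one member `≥ 1 − ε` in absolute value at every point, `ε ≤ 1/5`) satisfy the dichotomy

A second robustness of the Boolean corner, in the SUP direction and with NO auxiliary low-degree partition: if an
ℓ¹-bounded family `g` of degree `≤ d` is POINTWISE DOMINATED — at every `z` some member has `|g_i(z)| ≥ 1 − ε` (so the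
others sum to `≤ ε`), `ε ≤ 1/5` — then its decoupled polynomial `q = 1/2 + Σ_i (x_{y_i} − 1/2) g_i(z)` is pointwise within
`ε` of a Boolean function and has `Var q = V/4 ≥ (1−ε)²/4 ≥ 4ε²`, so the approximately-Boolean corner
(`…ApproxBooleanCorner.exists_influence_ge_of_approx_boolean`: Nisan–Szegedy with an approximating polynomial,
`D ≤ bs³`, robust OSSS) gives a variable of `q` with influence `≥ Var[q]²/(1024 (d+1)¹²)`; read back through
`stub_derivativeFamily`.  (`…L1FamilyBooleanCorner` is `ε = 0`; `…L1FamilyNearBoolean` is the `L²` direction.)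

* `l1Family_dominated` — `(∃ i, E[g_i²] ≥ V²/(2^26 d¹²)) ∨ (∃ j, Σ_i E[(g_i − g_i^{⊕j})²] ≥ V²/(2^24 d¹²))`;
* `l1Family_of_dominated` — the REGISTERED statement of `stub_l1Family` with the extra hypothesis "pointwise dominated
  with some `ε ≤ 1/5`", every regime, `(c, C) = (12, 2^{-28})`.

Honest label: a robust known corner; no stub, crux or summit is closed.  Sources: Nisan–Szegedy 1994; Beals et al. 2001
§5; O'Donnell–Saks–Schramm–Servedio 2005 Thm 3.2; O'Donnell–Zhao arXiv:1512.01603 eqn. (2.1).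
-/

-- D-0017: single-conjunct summit ⇒ the duplicate `QuantumAdvantage.QuantumAdvantage` is mandated.
set_option linter.dupNamespace false

noncomputable section

open Finset
open Literature.Computability.Complexity Literature.Computability.QuantumComplexity
open Summit.QuantumAdvantage.QuantumAdvantage.Cruxes.DecoupledCoreAA.L1Family.Equiv
  (evalBool_decoupledOf totalDegree_decoupledOf_le decoupledOf_bounded boolAvg_half_sq)
open Summit.QuantumAdvantage.QuantumAdvantage.Theorems.SosSandwich.ApproxBooleanCorner
  (exists_influence_ge_of_approx_boolean)

namespace Summit.QuantumAdvantage.QuantumAdvantage.Cruxes.DecoupledCoreAA.L1Family.Dominated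

variable {N : ℕ}

/-- In an ℓ¹-bounded family dominated at `z` by member `i` (`|g_i(z)| ≥ 1 − ε`), the signed half-sum
`Σ_k s_k g_k(z)/2` is within `ε/2`... more precisely the decoupled value `1/2 + Σ_k s_k g_k(z)/2` is within `ε` of
`{0,1}`. [folklore] -/
theorem decoupled_value_near_boolean {ι : Type*} [Fintype ι] [DecidableEq ι] (a : ι → ℝ) (s : ι → ℝ)
    (hs : ∀ k, s k = 1 ∨ s k = -1) (hl1 : ∑ k, |a k| ≤ 1) {ε : ℝ} {i : ι} (hi : 1 - ε ≤ |a i|) :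
    |(1 / 2 + ∑ k, s k * (1 / 2 * a k)) - 0| ≤ ε ∨ |(1 / 2 + ∑ k, s k * (1 / 2 * a k)) - 1| ≤ ε := by
  -- split off the dominant term
  have hsplit : ∑ k, s k * (1 / 2 * a k) = s i * (1 / 2 * a i) + ∑ k ∈ Finset.univ.erase i, s k * (1 / 2 * a k) := by
    rw [← Finset.add_sum_erase _ _ (Finset.mem_univ i)]
  have hrest_l1 : ∑ k ∈ Finset.univ.erase i, |a k| ≤ ε := by
    have := Finset.add_sum_erase Finset.univ (fun k => |a k|) (Finset.mem_univ i)
    linarith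
  have hrest : |∑ k ∈ Finset.univ.erase i, s k * (1 / 2 * a k)| ≤ ε / 2 := by
    calc |∑ k ∈ Finset.univ.erase i, s k * (1 / 2 * a k)|
        ≤ ∑ k ∈ Finset.univ.erase i, |s k * (1 / 2 * a k)| := Finset.abs_sum_le_sum_abs _ _
      _ = ∑ k ∈ Finset.univ.erase i, 1 / 2 * |a k| := by
          refine Finset.sum_congr rfl fun k _ => ?_
          rw [abs_mul, abs_mul]
          rcases hs k with h | h <;> rw [h] <;> norm_num
      _ = 1 / 2 * ∑ k ∈ Finset.univ.erase i, |a k| := by rw [Finset.mul_sum]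
      _ ≤ ε / 2 := by linarith
  have hai : |a i| ≤ 1 := (Finset.single_le_sum (fun k _ => abs_nonneg (a k)) (Finset.mem_univ i)).trans hl1
  set R := ∑ k ∈ Finset.univ.erase i, s k * (1 / 2 * a k) with hR
  rw [hsplit]
  have hRb := abs_le.mp hrest
  -- the dominant term `s_i a_i / 2` is within `ε/2` of `± 1/2`
  rcases hs i with h | h
  · rw [h, one_mul]
    rcases le_or_gt 0 (a i) with ha | ha
    · right
      rw [abs_of_nonneg ha] at hi hai
      rw [abs_le]; constructor <;> linarith
    · left
      rw [abs_of_neg ha] at hi hai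
      rw [abs_le]; constructor <;> linarith
  · rw [h]
    rcases le_or_gt 0 (a i) with ha | ha
    · left
      rw [abs_of_nonneg ha] at hi hai
      rw [abs_le]; constructor <;> linarith
    · right
      rw [abs_of_neg ha] at hi hai
      rw [abs_le]; constructor <;> linarith

/-- **Pointwise-dominated families satisfy the dichotomy polynomially.**  Let `g : Fin N → ℝ[x_1..x_N]` be ℓ¹-bounded
of degree `≤ d` (`d ≥ 1`) and POINTWISE DOMINATED: for some `ε ≤ 1/5`, at every `z` some member has `|g_i(z)| ≥ 1 − ε`.
Then, with `V = Σ_i E[g_i²]` (here `V ≥ (1−ε)² ≥ 16/25`),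
`(∃ i, E[g_i²] ≥ V²/(2^26 d¹²)) ∨ (∃ j, Σ_i E[(g_i − g_i^{⊕j})²] ≥ V²/(2^24 d¹²))`.
[cite: OdonnellEtAl2005, Thm 3.2] [cite: BealsEtAl2001, Thm 4.13] [cite: ODonnellZhao2016, eqn. (2.1)] -/
theorem l1Family_dominated {N d : ℕ} (g : Fin N → MvPolynomial (Fin N) ℝ) (hd : 1 ≤ d)
    (hdeg : ∀ i, (g i).totalDegree ≤ d) (hl1 : ∀ z, ∑ i, |evalBool (g i) z| ≤ 1) {ε : ℝ} (hε : ε ≤ 1 / 5)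
    (hdom : ∀ z, ∃ i, 1 - ε ≤ |evalBool (g i) z|) :
    (∃ i, (∑ i, boolAvg (fun z => evalBool (g i) z ^ 2)) ^ 2 / (2 ^ 26 * (d : ℝ) ^ 12) ≤
      boolAvg (fun z => evalBool (g i) z ^ 2)) ∨
    (∃ j, (∑ i, boolAvg (fun z => evalBool (g i) z ^ 2)) ^ 2 / (2 ^ 24 * (d : ℝ) ^ 12) ≤
      ∑ i, boolAvg (fun z => (evalBool (g i) z - evalBool (g i) (flipBit j z)) ^ 2)) := by
  classical
  set V := ∑ i, boolAvg (fun z => evalBool (g i) z ^ 2) with hVdef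
  set p : MvPolynomial (Fin (N + N)) ℝ := MvPolynomial.C (1 / 2 : ℝ) +
    ∑ i, (MvPolynomial.X (Fin.castAdd N i) - MvPolynomial.C (1 / 2 : ℝ)) *
      MvPolynomial.rename (Fin.natAdd N) (g i) with hp
  set g' : Fin N → (Fin N → Bool) → ℝ := fun i z => 1 / 2 * evalBool (g i) z with hg'
  have hformp : ∀ y z : Fin N → Bool,
      evalBool p (Fin.append y z) = 1 / 2 + ∑ i, (if y i then (1 : ℝ) else -1) * g' i z :=
    fun y z => evalBool_decoupledOf g y z
  have hpdeg : p.totalDegree ≤ d + 1 := totalDegree_decoupledOf_le g hdeg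
  have hpb : ∀ x, 0 ≤ evalBool p x ∧ evalBool p x ≤ 1 := decoupledOf_bounded g hl1
  -- `p` is pointwise within `ε` of the Boolean function `f = [p ≥ 1/2]`
  set f : (Fin (N + N) → Bool) → Bool := fun x => decide (1 / 2 ≤ evalBool p x) with hf
  have hε0 : 0 ≤ ε := by
    obtain ⟨i, hi⟩ := hdom (fun _ => false)
    have h1 : |evalBool (g i) fun _ => false| ≤ 1 :=
      (Finset.single_le_sum (fun k _ => abs_nonneg (evalBool (g k) fun _ => false)) (Finset.mem_univ i)).trans
        (hl1 _)
    linarith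
  have happ : ∀ x, |evalBool p x - realOf f x| ≤ ε := by
    intro x
    have hx := Fin.append_castAdd_natAdd (f := x)
    set y : Fin N → Bool := fun i => x (Fin.castAdd N i)
    set z : Fin N → Bool := fun i => x (Fin.natAdd N i)
    have hpx : evalBool p x = 1 / 2 + ∑ k, (if y k then (1 : ℝ) else -1) * (1 / 2 * evalBool (g k) z) := by
      rw [← hx, hformp]
    obtain ⟨i, hi⟩ := hdom z
    have hnear := decoupled_value_near_boolean (fun k => evalBool (g k) z) (fun k => if y k then (1 : ℝ) else -1)
      (fun k => by cases y k <;> simp) (hl1 z) hi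
    rw [← hpx] at hnear
    have hε12 : ε < 1 / 2 := by linarith
    rcases hnear with h0 | h1
    · -- near 0, so `f x = false`
      have hlt : evalBool p x < 1 / 2 := by
        have := (abs_le.mp h0).2; linarith
      have hfx' : f x = false := by
        simp only [hf, decide_eq_false_iff_not, not_le]; exact hlt
      have hfx : realOf f x = 0 := by rw [realOf_apply, hfx']; simp
      rw [hfx]; exact h0
    · have hge : 1 / 2 ≤ evalBool p x := by
        have := (abs_le.mp h1).1; linarith
      have hfx' : f x = true := by
        simp only [hf, decide_eq_true_eq]; exact hge
      have hfx : realOf f x = 1 := by rw [realOf_apply, hfx']; simp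
      rw [hfx]; exact h1
  -- data of `p`
  obtain ⟨-, hinfy, hinfz, hvar, -⟩ := stub_derivativeFamily N (d + 1) p (1 / 2) g' hformp hpdeg hpb
  have hmass : ∀ i, boolAvg (fun z => g' i z ^ 2) = 1 / 4 * boolAvg (fun z => evalBool (g i) z ^ 2) :=
    fun i => boolAvg_half_sq _
  have hdiff : ∀ j i, boolAvg (fun z => (g' i z - g' i (flipBit j z)) ^ 2) =
      1 / 4 * boolAvg (fun z => (evalBool (g i) z - evalBool (g i) (flipBit j z)) ^ 2) := by
    intro j i
    have e : (fun z => (g' i z - g' i (flipBit j z)) ^ 2) =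
        fun z => (1 / 2 * (evalBool (g i) z - evalBool (g i) (flipBit j z))) ^ 2 := by
      funext z; rw [hg']; ring
    rw [e]
    exact boolAvg_half_sq _
  have hvarV : boolVariance p = 1 / 4 * V := by
    rw [hvar, hVdef, Finset.mul_sum]
    exact Finset.sum_congr rfl fun i _ => hmass i
  -- `V ≥ (1 − ε)²`: pointwise `Σ_i g_i(z)² ≥ g_{i(z)}(z)² ≥ (1−ε)²`
  have hVge : (1 - ε) ^ 2 ≤ V := by
    have hpt : ∀ z, (1 - ε) ^ 2 ≤ ∑ i, evalBool (g i) z ^ 2 := by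
      intro z
      obtain ⟨i, hi⟩ := hdom z
      have h1e : 0 ≤ 1 - ε := by linarith
      calc (1 - ε) ^ 2 ≤ |evalBool (g i) z| ^ 2 := pow_le_pow_left₀ h1e hi 2
        _ = evalBool (g i) z ^ 2 := sq_abs _
        _ ≤ ∑ k, evalBool (g k) z ^ 2 := Finset.single_le_sum (fun k _ => sq_nonneg (evalBool (g k) z)) (Finset.mem_univ i)
    have hsum : ∑ i, boolAvg (fun z => evalBool (g i) z ^ 2) = boolAvg (fun z => ∑ i, evalBool (g i) z ^ 2) := by
      unfold boolAvg; rw [← Finset.sum_div, Finset.sum_comm]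
    rw [hVdef, hsum]
    calc (1 - ε) ^ 2 = boolAvg (fun _ : Fin N → Bool => (1 - ε) ^ 2) := (boolAvg_const _).symm
      _ ≤ boolAvg (fun z => ∑ i, evalBool (g i) z ^ 2) := by
          unfold boolAvg
          exact div_le_div_of_nonneg_right (Finset.sum_le_sum fun z _ => hpt z) (by positivity)
  have hVpos : 0 < V := lt_of_lt_of_le (by nlinarith) hVge
  have hvpos : 0 < boolVariance p := by rw [hvarV]; positivity
  have hvar4 : 4 * ε ^ 2 ≤ boolVariance p := by
    rw [hvarV]; nlinarith
  have hε3 : ε ≤ 1 / 3 := by linarith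
  obtain ⟨j, hj⟩ := exists_influence_ge_of_approx_boolean p hpdeg hpb f hε3 happ hvar4 hvpos
  rw [hvarV] at hj
  -- `(d+1)^12 ≤ 4096 d^12`
  have hd1 : (1 : ℝ) ≤ (d : ℝ) := by exact_mod_cast hd
  have hd0 : (0 : ℝ) < (d : ℝ) := by positivity
  have hpow : ((d + 1 : ℕ) : ℝ) ^ 12 ≤ 4096 * (d : ℝ) ^ 12 := by
    have h2 : ((d + 1 : ℕ) : ℝ) ≤ 2 * (d : ℝ) := by push_cast; linarith
    calc ((d + 1 : ℕ) : ℝ) ^ 12 ≤ (2 * (d : ℝ)) ^ 12 := pow_le_pow_left₀ (by positivity) h2 12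
      _ = 4096 * (d : ℝ) ^ 12 := by ring
  have hI := influence_nonneg j p
  have hInf : V ^ 2 / (2 ^ 26 * (d : ℝ) ^ 12) ≤ influence j p := by
    rw [div_le_iff₀ (by positivity)]
    have hden : (0 : ℝ) < 1024 * ((d + 1 : ℕ) : ℝ) ^ 12 := by positivity
    have h' := (div_le_iff₀ hden).mp hj
    nlinarith [h', hpow, hI, sq_nonneg V]
  revert hInf
  refine Fin.addCases (fun i => ?_) (fun j' => ?_) j
  · intro hInf
    left
    refine ⟨i, ?_⟩
    rw [hinfy i, hmass i] at hInf
    linarith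
  · intro hInf
    right
    refine ⟨j', ?_⟩
    rw [hinfz j'] at hInf
    simp_rw [hdiff j'] at hInf
    rw [← Finset.mul_sum] at hInf
    have e : V ^ 2 / (2 ^ 24 * (d : ℝ) ^ 12) = 4 * (V ^ 2 / (2 ^ 26 * (d : ℝ) ^ 12)) := by
      field_simp; ring
    rw [e]
    linarith

/-- **`stub_l1Family` for pointwise-dominated families, every regime** (`(c, C) = (12, 2^{-28})`): the REGISTERED statement
with the extra hypothesis `∃ ε ≤ 1/5, ∀ z, ∃ i, 1 − ε ≤ |g_i(z)|` (then `V ≥ 16/25` and the regime is not used).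
[cite: OdonnellEtAl2005, Thm 3.2] [cite: ODonnellZhao2016, Thm. 2.13] -/
theorem l1Family_of_dominated :
    ∀ (κ₀ : ℕ) (K₀ : ℝ), 0 < K₀ → ∃ (c : ℕ) (C : ℝ), 0 < C ∧
      ∀ (N d : ℕ) (g : Fin N → MvPolynomial (Fin N) ℝ),
        (∃ ε : ℝ, ε ≤ 1 / 5 ∧ ∀ z, ∃ i, 1 - ε ≤ |evalBool (g i) z|) →
        1 ≤ d → (∀ i, (g i).totalDegree ≤ d) →
        (∀ z, ∑ i, |evalBool (g i) z| ≤ 1) →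
        1 ≤ K₀ * (d : ℝ) ^ κ₀ * ∑ i, boolAvg (fun z => evalBool (g i) z ^ 2) →
        (∃ i, C / (d : ℝ) ^ c ≤ boolAvg (fun z => evalBool (g i) z ^ 2)) ∨
        (∃ j, C / (d : ℝ) ^ c ≤
          ∑ i, boolAvg (fun z => (evalBool (g i) z - evalBool (g i) (flipBit j z)) ^ 2)) := by
  intro κ₀ K₀ _hK₀
  refine ⟨12, 1 / 2 ^ 28, by positivity, ?_⟩
  intro N d g hdomε hd hdeg hl1 _hreg
  obtain ⟨ε, hε, hdom⟩ := hdomε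
  set V := ∑ i, boolAvg (fun z => evalBool (g i) z ^ 2) with hVdef
  -- `V ≥ (1−ε)² ≥ 16/25`, so `V² ≥ 1/4`
  have hVge : (1 - ε) ^ 2 ≤ V := by
    have hpt : ∀ z, (1 - ε) ^ 2 ≤ ∑ i, evalBool (g i) z ^ 2 := by
      intro z
      obtain ⟨i, hi⟩ := hdom z
      have h1e : 0 ≤ 1 - ε := by linarith
      calc (1 - ε) ^ 2 ≤ |evalBool (g i) z| ^ 2 := pow_le_pow_left₀ h1e hi 2
        _ = evalBool (g i) z ^ 2 := sq_abs _
        _ ≤ ∑ k, evalBool (g k) z ^ 2 := Finset.single_le_sum (fun k _ => sq_nonneg (evalBool (g k) z)) (Finset.mem_univ i)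
    have hsum : ∑ i, boolAvg (fun z => evalBool (g i) z ^ 2) = boolAvg (fun z => ∑ i, evalBool (g i) z ^ 2) := by
      unfold boolAvg; rw [← Finset.sum_div, Finset.sum_comm]
    rw [hVdef, hsum]
    calc (1 - ε) ^ 2 = boolAvg (fun _ : Fin N → Bool => (1 - ε) ^ 2) := (boolAvg_const _).symm
      _ ≤ boolAvg (fun z => ∑ i, evalBool (g i) z ^ 2) := by
          unfold boolAvg
          exact div_le_div_of_nonneg_right (Finset.sum_le_sum fun z _ => hpt z) (by positivity)
  have h45 : (4 : ℝ) / 5 ≤ 1 - ε := by linarith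
  have hV0 : 16 / 25 ≤ V := le_trans (by nlinarith [pow_le_pow_left₀ (by norm_num : (0:ℝ) ≤ 4 / 5) h45 2]) hVge
  have hV2 : 1 / 4 ≤ V ^ 2 := by nlinarith [hV0]
  have hd0 : (0 : ℝ) < (d : ℝ) := by exact_mod_cast hd
  have hd12 : (0 : ℝ) < (d : ℝ) ^ 12 := by positivity
  rcases l1Family_dominated g hd hdeg hl1 hε hdom with ⟨i, hi⟩ | ⟨j, hj⟩
  · left
    refine ⟨i, le_trans ?_ hi⟩
    rw [div_le_div_iff₀ hd12 (by positivity)]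
    nlinarith
  · right
    refine ⟨j, le_trans ?_ hj⟩
    rw [div_le_div_iff₀ hd12 (by positivity)]
    nlinarith

end Summit.QuantumAdvantage.QuantumAdvantage.Cruxes.DecoupledCoreAA.L1Family.Dominated

end
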